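import Summits.AtomisticToContinuum.BoseEinsteinCondensation.Theorems.BECGroundStateSOSRimSqueezeDefs
import Summits.AtomisticToContinuum.BoseEinsteinCondensation.Theorems.BECCutLineWeakDisorderGroundStateRigidityStubCompactness
import Literature.MathematicalPhysics.QuantumManyBody.BoseGasCutoffState
import Literature.MathematicalPhysics.QuantumManyBody.JelliumBoseGasDilation
import Mathlib.MeasureTheory.Integral.MeanInequalities
import Mathlib.MeasureTheory.Integral.IntervalIntegral.FundThmCalculus

/-!
# Route `BECGroundStateSOS`, crux `BoundaryTransferWeak` (stmt-AtomisticToContinuum-0827),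
# line `rim-squeeze-monotone-coherence`, stub (L): `L²`-modulus of continuity from the kinetic energy

Supports (does not close) stmt-AtomisticToContinuum-0827; auxiliary block of the registered stub
`stub_hardWallLimit` (L) (lead c3). The near-minimiser transfer across the hard wall (to which
`…HardWallLimitAux.lean` reduced (L)) moves states by small translations (the `2h`-shift of the
rim-layer cut-off, `…HardWallLimitCutoffState.lean`) and small dilations (the shrink of the fattened
cube); both are `L²`-small UNIFORMLY on bounded-kinetic-energy families, by the elementary
modulus of continuity of a `C¹` function along a segment:

* `ennnorm_sub_sq_le_lintegral_kineticDensity` — **pointwise**: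
  `|ψ(X + V) - ψ(X)|² ≤ 3N ‖V‖² ∫₀¹ |∇ψ|²(X + sV) ds` (fundamental theorem of calculus along
  `s ↦ X + sV`, Cauchy–Schwarz on `[0,1]`, and `‖Dψ‖² ≤ 3N |∇ψ|²`, `nnnorm_fderiv_sq_le`);
* `lintegral_cellN_sub_translate_sq_le` (anchor `stub_hardWallLimit_modulus`) — **periodic states under
  translation**: `∫_cell |Ψ(· + T) - Ψ|² ≤ 3N ‖T‖² ∫_cell |∇Ψ|²` (Tonelli and the translation
  invariance of cell integrals of periodic integrands, `lintegral_cellN_comp_add`).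

All `[folklore]`.
-/

noncomputable section

namespace Summit.AtomisticToContinuum.BoseEinsteinCondensation.RimSqueeze

open Literature.MathematicalPhysics.QuantumManyBody.BoseGas
open MeasureTheory Filter Set
open scoped ENNReal NNReal ComplexConjugate
open Summit.AtomisticToContinuum.BoseEinsteinCondensation.Theorems.GroundStateRigidity
  (nnnorm_fderiv_sq_le)

variable {N : ℕ} {L : ℝ}

/-- Cauchy–Schwarz on the unit interval: `(∫₀¹ f)² ≤ ∫₀¹ f²`. [folklore] -/
theorem lintegral_Ioc_sq_le {f : ℝ → ℝ≥0∞} (hf : AEMeasurable f (volume.restrict (Ioc (0 : ℝ) 1))) :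
    (∫⁻ s in Ioc (0 : ℝ) 1, f s) ^ 2 ≤ ∫⁻ s in Ioc (0 : ℝ) 1, f s ^ 2 := by
  have h := ENNReal.lintegral_mul_le_Lp_mul_Lq (volume.restrict (Ioc (0 : ℝ) 1))
    Real.HolderConjugate.two_two hf aemeasurable_const (g := fun _ => 1)
  simp only [Pi.mul_apply, mul_one, ENNReal.one_rpow, lintegral_const, Measure.restrict_apply_univ,
    Real.volume_Ioc, sub_zero, ENNReal.ofReal_one, one_div] at h
  have h' : (∫⁻ s in Ioc (0 : ℝ) 1, f s) ≤ (∫⁻ s in Ioc (0 : ℝ) 1, f s ^ 2) ^ (1 / 2 : ℝ) := by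
    simpa only [ENNReal.rpow_two, one_div, ENNReal.one_rpow, mul_one] using h
  calc (∫⁻ s in Ioc (0 : ℝ) 1, f s) ^ 2 ≤ ((∫⁻ s in Ioc (0 : ℝ) 1, f s ^ 2) ^ (1 / 2 : ℝ)) ^ 2 := by
        gcongr
    _ = _ := by
        rw [← ENNReal.rpow_two, ← ENNReal.rpow_mul]
        norm_num

/-- **Pointwise modulus of continuity of a `C¹` function along a segment**:
`|ψ(X + V) - ψ(X)|² ≤ 3N ‖V‖² ∫₀¹ |∇ψ|²(X + sV) ds` (`ℝ≥0∞` form; `‖V‖` is the configuration-space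
norm, the sup over particles of Euclidean norms). [folklore] -/
theorem ennnorm_sub_sq_le_lintegral_kineticDensity {ψ : Config N → ℂ} (hψ : ContDiff ℝ 1 ψ)
    (X V : Config N) :
    (‖ψ (X + V) - ψ X‖₊ : ℝ≥0∞) ^ 2 ≤
      (3 * N : ℝ≥0∞) * ENNReal.ofReal (‖V‖ ^ 2) *
        ∫⁻ s in Ioc (0 : ℝ) 1, kineticDensity ψ (X + s • V) := by
  -- the path and its derivative
  set g : ℝ → ℂ := fun s => ψ (X + s • V) with hg
  set g' : ℝ → ℂ := fun s => fderiv ℝ ψ (X + s • V) V with hg'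
  have hderiv : ∀ s, HasDerivAt g (g' s) s := by
    intro s
    have hp : HasDerivAt (fun s : ℝ => X + s • V) V s := by
      simpa using ((hasDerivAt_id s).smul_const V).const_add X
    exact (((hψ.differentiable one_ne_zero) (X + s • V)).hasFDerivAt).comp_hasDerivAt s hp
  have hDc : Continuous fun s : ℝ => fderiv ℝ ψ (X + s • V) :=
    (hψ.continuous_fderiv one_ne_zero).comp
      (continuous_const.add (continuous_id.smul continuous_const))
  have hg'c : Continuous g' := hDc.clm_apply continuous_const
  have hftc : ψ (X + V) - ψ X = ∫ s in (0 : ℝ)..1, g' s := by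
    rw [intervalIntegral.integral_eq_sub_of_hasDerivAt (fun s _ => hderiv s)
      (hg'c.intervalIntegrable 0 1)]
    simp [hg]
  -- the norm bound `‖ψ(X+V) - ψ(X)‖ ≤ (∫₀¹ ‖Dψ(X + sV)‖) ‖V‖`
  have hnorm : ‖ψ (X + V) - ψ X‖ ≤ (∫ s in Ioc (0 : ℝ) 1, ‖fderiv ℝ ψ (X + s • V)‖) * ‖V‖ := by
    rw [hftc, ← intervalIntegral.integral_of_le zero_le_one, ← intervalIntegral.integral_mul_const]
    refine (intervalIntegral.norm_integral_le_integral_norm zero_le_one).trans ?_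
    refine intervalIntegral.integral_mono_on zero_le_one (hg'c.norm.intervalIntegrable 0 1)
      ((hDc.norm.mul continuous_const).intervalIntegrable 0 1) fun s _ => ?_
    exact ContinuousLinearMap.le_opNorm _ _
  -- to `ℝ≥0∞`
  have hI : ENNReal.ofReal (∫ s in Ioc (0 : ℝ) 1, ‖fderiv ℝ ψ (X + s • V)‖) =
      ∫⁻ s in Ioc (0 : ℝ) 1, (‖fderiv ℝ ψ (X + s • V)‖₊ : ℝ≥0∞) := by
    rw [ofReal_integral_eq_lintegral_ofReal (hDc.norm.integrableOn_Icc.mono_set Ioc_subset_Icc_self)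
      (ae_of_all _ fun s => norm_nonneg _)]
    refine lintegral_congr fun s => ?_
    rw [← enorm_eq_nnnorm, ofReal_norm]
  have hmeas : AEMeasurable (fun s => (‖fderiv ℝ ψ (X + s • V)‖₊ : ℝ≥0∞))
      (volume.restrict (Ioc (0 : ℝ) 1)) :=
    hDc.measurable.nnnorm.coe_nnreal_ennreal.aemeasurable
  have h1 : (‖ψ (X + V) - ψ X‖₊ : ℝ≥0∞) ≤
      (∫⁻ s in Ioc (0 : ℝ) 1, (‖fderiv ℝ ψ (X + s • V)‖₊ : ℝ≥0∞)) * ENNReal.ofReal ‖V‖ := by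
    rw [← hI, ← ENNReal.ofReal_mul (integral_nonneg fun s => norm_nonneg _), ← enorm_eq_nnnorm,
      ← ofReal_norm]
    exact ENNReal.ofReal_le_ofReal hnorm
  calc (‖ψ (X + V) - ψ X‖₊ : ℝ≥0∞) ^ 2
      ≤ ((∫⁻ s in Ioc (0 : ℝ) 1, (‖fderiv ℝ ψ (X + s • V)‖₊ : ℝ≥0∞)) * ENNReal.ofReal ‖V‖) ^ 2 := by
        gcongr
    _ = (∫⁻ s in Ioc (0 : ℝ) 1, (‖fderiv ℝ ψ (X + s • V)‖₊ : ℝ≥0∞)) ^ 2 *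
          ENNReal.ofReal (‖V‖ ^ 2) := by
        rw [mul_pow, ENNReal.ofReal_pow (norm_nonneg _)]
    _ ≤ (∫⁻ s in Ioc (0 : ℝ) 1, (‖fderiv ℝ ψ (X + s • V)‖₊ : ℝ≥0∞) ^ 2) *
          ENNReal.ofReal (‖V‖ ^ 2) := by
        gcongr
        exact lintegral_Ioc_sq_le hmeas
    _ ≤ (∫⁻ s in Ioc (0 : ℝ) 1, (3 * N : ℝ≥0∞) * kineticDensity ψ (X + s • V)) *
          ENNReal.ofReal (‖V‖ ^ 2) := by
        gcongr with s
        exact nnnorm_fderiv_sq_le ψ _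
    _ = _ := by
        rw [lintegral_const_mul' _ _ (ENNReal.mul_ne_top (by norm_num) (ENNReal.natCast_ne_top N))]
        ring

/-- **`L²`-modulus of continuity of a periodic trial state under translation, from its kinetic
energy**: `∫_cell |Ψ(· + T) - Ψ|² ≤ 3N ‖T‖² ∫_cell |∇Ψ|²` (pointwise bound, Tonelli, and for every
`s` the cell integral of the periodic `|∇Ψ|²(· + sT)` is that of `|∇Ψ|²`). [folklore] -/
theorem lintegral_cellN_sub_translate_sq_le (hL : 0 < L) (Ψ : PeriodicTrialState N L) (T : Config N) :
    ∫⁻ X in cellN N L, (‖Ψ.ψ (X + T) - Ψ.ψ X‖₊ : ℝ≥0∞) ^ 2 ≤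
      (3 * N : ℝ≥0∞) * ENNReal.ofReal (‖T‖ ^ 2) * ∫⁻ X in cellN N L, kineticDensity Ψ.ψ X := by
  have hC : (3 * N : ℝ≥0∞) * ENNReal.ofReal (‖T‖ ^ 2) ≠ ⊤ :=
    ENNReal.mul_ne_top (ENNReal.mul_ne_top (by norm_num) (ENNReal.natCast_ne_top N))
      ENNReal.ofReal_ne_top
  have hKper : ∀ (Y : Config N) (i : Fin N) (k : Fin 3),
      kineticDensity Ψ.ψ (Y + Pi.single i (EuclideanSpace.single k L)) = kineticDensity Ψ.ψ Y :=
    kineticDensity_add_single_of_periodic Ψ.periodic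
  have hunc : AEMeasurable (Function.uncurry fun (X : Config N) (s : ℝ) =>
      kineticDensity Ψ.ψ (X + s • T)) ((volume.restrict (cellN N L)).prod
        (volume.restrict (Ioc (0 : ℝ) 1))) := by
    refine ((measurable_kineticDensity Ψ.contDiff).comp ?_).aemeasurable
    exact measurable_fst.add (measurable_snd.smul measurable_const)
  calc ∫⁻ X in cellN N L, (‖Ψ.ψ (X + T) - Ψ.ψ X‖₊ : ℝ≥0∞) ^ 2
      ≤ ∫⁻ X in cellN N L, (3 * N : ℝ≥0∞) * ENNReal.ofReal (‖T‖ ^ 2) *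
          ∫⁻ s in Ioc (0 : ℝ) 1, kineticDensity Ψ.ψ (X + s • T) :=
        lintegral_mono fun X => ennnorm_sub_sq_le_lintegral_kineticDensity Ψ.contDiff X T
    _ = (3 * N : ℝ≥0∞) * ENNReal.ofReal (‖T‖ ^ 2) *
          ∫⁻ X in cellN N L, ∫⁻ s in Ioc (0 : ℝ) 1, kineticDensity Ψ.ψ (X + s • T) :=
        lintegral_const_mul' _ _ hC
    _ = (3 * N : ℝ≥0∞) * ENNReal.ofReal (‖T‖ ^ 2) *
          ∫⁻ s in Ioc (0 : ℝ) 1, ∫⁻ X in cellN N L, kineticDensity Ψ.ψ (X + s • T) := by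
        rw [lintegral_lintegral_swap hunc]
    _ = (3 * N : ℝ≥0∞) * ENNReal.ofReal (‖T‖ ^ 2) *
          ∫⁻ _s in Ioc (0 : ℝ) 1, ∫⁻ X in cellN N L, kineticDensity Ψ.ψ X := by
        congr 1
        exact lintegral_congr fun s => lintegral_cellN_comp_add hL hKper (s • T)
    _ = _ := by
        rw [setLIntegral_const, Real.volume_Ioc, sub_zero, ENNReal.ofReal_one, mul_one]

/-- On the open box of side `ℓ` the configuration norm is controlled: `‖Z‖² ≤ 3ℓ²`. [folklore] -/
theorem norm_sq_le_of_mem_boxN {ℓ : ℝ} {Z : Config N} (hZ : Z ∈ boxN N ℓ) : ‖Z‖ ^ 2 ≤ 3 * ℓ ^ 2 := by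
  have hi : ∀ i, ‖Z i‖ ^ 2 ≤ 3 * ℓ ^ 2 := by
    intro i
    rw [EuclideanSpace.norm_eq, Real.sq_sqrt (Finset.sum_nonneg fun k _ => sq_nonneg _)]
    calc ∑ k, ‖Z i k‖ ^ 2 ≤ ∑ _k : Fin 3, ℓ ^ 2 := by
          refine Finset.sum_le_sum fun k _ => ?_
          have h1 := (hZ i k).1
          have h2 := (hZ i k).2
          rw [Real.norm_eq_abs, sq_abs]
          nlinarith
      _ = 3 * ℓ ^ 2 := by simp
  have hZn : ‖Z‖ ≤ Real.sqrt (3 * ℓ ^ 2) := by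
    refine (pi_norm_le_iff_of_nonneg (Real.sqrt_nonneg _)).2 fun i => ?_
    rw [← Real.sqrt_sq (norm_nonneg (Z i))]
    exact Real.sqrt_le_sqrt (hi i)
  calc ‖Z‖ ^ 2 ≤ (Real.sqrt (3 * ℓ ^ 2)) ^ 2 := pow_le_pow_left₀ (norm_nonneg _) hZn 2
    _ = 3 * ℓ ^ 2 := Real.sq_sqrt (by positivity)

/-- **`L²`-modulus of continuity of a Dirichlet trial state under dilation, from its kinetic
energy**: for `κ ≥ 0`, `∫ |Φ((1+κ)Y) - Φ(Y)|² dY ≤ 3N · 3κ²ℓ² · ∫ |∇Φ|²` (pointwise bound along the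
ray `s ↦ (1 + sκ)Y`, where only `‖Y‖² ≤ 3ℓ²` matters since `Φ` lives in the box; Tonelli; and
`∫ |∇Φ|²((1+sκ) ·) = (1+sκ)^{-3N} ∫ |∇Φ|² ≤ ∫ |∇Φ|²`, Haar scaling). [folklore] -/
theorem lintegral_sub_dilate_sq_le {ℓ : ℝ} (Φ : TrialState N ℓ) {κ : ℝ} (hκ : 0 ≤ κ) :
    ∫⁻ Y, (‖Φ.ψ ((1 + κ) • Y) - Φ.ψ Y‖₊ : ℝ≥0∞) ^ 2 ≤
      (3 * N : ℝ≥0∞) * ENNReal.ofReal (3 * κ ^ 2 * ℓ ^ 2) * ∫⁻ Y, kineticDensity Φ.ψ Y := by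
  have hC : (3 * N : ℝ≥0∞) * ENNReal.ofReal (3 * κ ^ 2 * ℓ ^ 2) ≠ ⊤ :=
    ENNReal.mul_ne_top (ENNReal.mul_ne_top (by norm_num) (ENNReal.natCast_ne_top N))
      ENNReal.ofReal_ne_top
  -- pointwise bound
  have hpt : ∀ Y, (‖Φ.ψ ((1 + κ) • Y) - Φ.ψ Y‖₊ : ℝ≥0∞) ^ 2 ≤
      (3 * N : ℝ≥0∞) * ENNReal.ofReal (3 * κ ^ 2 * ℓ ^ 2) *
        ∫⁻ s in Ioc (0 : ℝ) 1, kineticDensity Φ.ψ ((1 + s * κ) • Y) := by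
    intro Y
    by_cases hY : ‖Y‖ ^ 2 ≤ 3 * ℓ ^ 2
    · have h := ennnorm_sub_sq_le_lintegral_kineticDensity Φ.contDiff Y (κ • Y)
      have e1 : Y + κ • Y = (1 + κ) • Y := by rw [add_smul, one_smul]
      have e2 : ∀ s : ℝ, Y + s • (κ • Y) = (1 + s * κ) • Y := fun s => by
        rw [add_smul, one_smul, smul_smul]
      rw [e1] at h
      simp_rw [e2] at h
      refine h.trans ?_
      gcongr
      rw [norm_smul, mul_pow, Real.norm_eq_abs, sq_abs]
      nlinarith [mul_le_mul_of_nonneg_left hY (sq_nonneg κ)]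
    · have h1 : Φ.ψ Y = 0 := Φ.eq_zero Y fun hY' => hY (norm_sq_le_of_mem_boxN hY')
      have h2 : Φ.ψ ((1 + κ) • Y) = 0 := by
        refine Φ.eq_zero _ fun hY' => hY ?_
        have h3 := norm_sq_le_of_mem_boxN hY'
        rw [norm_smul, mul_pow, Real.norm_eq_abs, sq_abs] at h3
        nlinarith [sq_nonneg ‖Y‖, mul_le_mul_of_nonneg_right
          (show (1 : ℝ) ≤ (1 + κ) ^ 2 by nlinarith) (sq_nonneg ‖Y‖)]
      simp [h1, h2]
  have hunc : AEMeasurable (Function.uncurry fun (Y : Config N) (s : ℝ) =>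
      kineticDensity Φ.ψ ((1 + s * κ) • Y)) (volume.prod (volume.restrict (Ioc (0 : ℝ) 1))) := by
    refine ((measurable_kineticDensity Φ.contDiff).comp ?_).aemeasurable
    exact ((measurable_const.add (measurable_snd.mul measurable_const)).smul measurable_fst)
  -- Haar scaling: `∫ |∇Φ|²(r ·) ≤ ∫ |∇Φ|²` for `r ≥ 1`
  have hscale : ∀ s ∈ Ioc (0 : ℝ) 1,
      ∫⁻ Y, kineticDensity Φ.ψ ((1 + s * κ) • Y) ≤ ∫⁻ Y, kineticDensity Φ.ψ Y := by
    intro s hs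
    have hr : 1 ≤ 1 + s * κ := by nlinarith [hs.1.le]
    rw [lintegral_comp_smul_addHaar volume (kineticDensity Φ.ψ) (by positivity : (1 + s * κ) ≠ 0)]
    refine mul_le_of_le_one_left zero_le ?_
    rw [← ENNReal.ofReal_one]
    refine ENNReal.ofReal_le_ofReal ?_
    rw [abs_of_nonneg (by positivity)]
    exact inv_le_one_of_one_le₀ (one_le_pow₀ hr)
  calc ∫⁻ Y, (‖Φ.ψ ((1 + κ) • Y) - Φ.ψ Y‖₊ : ℝ≥0∞) ^ 2
      ≤ ∫⁻ Y, (3 * N : ℝ≥0∞) * ENNReal.ofReal (3 * κ ^ 2 * ℓ ^ 2) *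
          ∫⁻ s in Ioc (0 : ℝ) 1, kineticDensity Φ.ψ ((1 + s * κ) • Y) := lintegral_mono hpt
    _ = (3 * N : ℝ≥0∞) * ENNReal.ofReal (3 * κ ^ 2 * ℓ ^ 2) *
          ∫⁻ Y, ∫⁻ s in Ioc (0 : ℝ) 1, kineticDensity Φ.ψ ((1 + s * κ) • Y) :=
        lintegral_const_mul' _ _ hC
    _ = (3 * N : ℝ≥0∞) * ENNReal.ofReal (3 * κ ^ 2 * ℓ ^ 2) *
          ∫⁻ s in Ioc (0 : ℝ) 1, ∫⁻ Y, kineticDensity Φ.ψ ((1 + s * κ) • Y) := by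
        rw [lintegral_lintegral_swap hunc]
    _ ≤ (3 * N : ℝ≥0∞) * ENNReal.ofReal (3 * κ ^ 2 * ℓ ^ 2) *
          ∫⁻ _s in Ioc (0 : ℝ) 1, ∫⁻ Y, kineticDensity Φ.ψ Y :=
        mul_le_mul_right (setLIntegral_mono' measurableSet_Ioc hscale) _
    _ = _ := by
        rw [setLIntegral_const, Real.volume_Ioc, sub_zero, ENNReal.ofReal_one, mul_one]

/-- **Anchor of this block** (quantified form of `lintegral_cellN_sub_translate_sq_le`). [folklore] -/
theorem stub_hardWallLimit_modulus : ∀ {N : ℕ} {L : ℝ}, 0 < L → ∀ (Ψ : PeriodicTrialState N L) (T : Config N), ∫⁻ X in cellN N L, (‖Ψ.ψ (X + T) - Ψ.ψ X‖₊ : ℝ≥0∞) ^ 2 ≤ (3 * N : ℝ≥0∞) * ENNReal.ofReal (‖T‖ ^ 2) * ∫⁻ X in cellN N L, kineticDensity Ψ.ψ X :=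
  fun hL Ψ T => lintegral_cellN_sub_translate_sq_le hL Ψ T

end Summit.AtomisticToContinuum.BoseEinsteinCondensation.RimSqueeze

end
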